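import Mathlib
import HarnessLib
import Literature.Analysis.FluidPDE.VorticityCalculus
import Literature.Analysis.FluidPDE.HessianLpVector
import Summits.NavierStokesRegularity.NavierStokesRegularity.Theorems.LocalSineTubeDoorProfileAlignedWindowRigidityAncient
import Summits.NavierStokesRegularity.NavierStokesRegularity.Theorems.PoloidalWindowDoorPoloidalWindowRigidityLeafUniformPins

/-!
# Route `PoloidalWindowDoor`, crux `PoloidalWindowRigidity` (stmt-NavierStokesRegularity-19708) — LINE 18 «leaf_uniform» v1.3 (ns-idea-8 g9): support R20
# `HotFlatPointHFlat`, VERBATIM (Cruxes-local `Pinned`, `hotSet`, `lapH`, `hess`, `HFlat` unfolded)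

Cell ns-regularity-ideate, seat ns-poloidal-K2-p2 g13 (K2 hand).  R20 (v1.3, «PROVABLE, S/M; support»): a hot point `y` (`y 2 = 0`, `v₂(−1,y) = N := v₂(−1,0)`)
with vanishing horizontal Laplacian `Δₕv₂(−1,y) = 0` is HORIZONTALLY FLAT: `D²v₂(−1,·)(y)[a,b] = D²v₂(−1,·)(y)[b,a] = 0` for every horizontal `a` (`a 2 = 0`) and
every `b`, in the column's nested-`fderiv` spelling `hess v y a b = D(x ↦ Dv₂(x)a)(y)b`.

Proof (the docstring's): `y` is a global extremum of `w = v₂(−1,·)` (the `Pinned` bound at `t = −1`), so `N·D²w(y)[a,a] ≤ 0` for every `a`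
(`…LeafUniformPins.mul_iteratedFDeriv_two_nonpos`); `N·(D²w[e₀,e₀] + D²w[e₁,e₁]) = 0` forces both diagonal entries to vanish; for the negative-semidefinite
SYMMETRIC form `G = N·D²w(y)` (`ContDiffAt.isSymmSndFDerivAt`), `G[a,a] = 0 ⇒ G[a,·] = 0` (the quadratic `t ↦ G[a+tb,a+tb] ≤ 0`), whence `G[e₀,·] = G[e₁,·] = 0`
and by linearity/symmetry `G[a,b] = G[b,a] = 0` for horizontal `a`; divide by `N ≠ 0`.

HONEST LABEL: one S/M support of LINE 18; R8/R11/R15–R19 and the research cells are NOT touched; C2a′ / ⟨19708⟩ / ⟨20428⟩ OPEN; NS regularity NOT proved.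
-/

noncomputable section

-- the summit and its single sub-problem share the name (CONVENTIONS §1), as in every Theorems file
set_option linter.dupNamespace false

namespace Summit.NavierStokesRegularity.NavierStokesRegularity.Theorems.PoloidalWindowDoorPoloidalWindowRigidityLeafUniformHFlat

open Set Function Filter Topology
open scoped InnerProductSpace RealInnerProductSpace Laplacian
open Literature.Analysis Literature.Analysis.FluidPDE Literature.Analysis.UnboundedOperators
open Summit.NavierStokesRegularity.NavierStokesRegularity.Theorems.LocalSineTubeDoorProfileAlignedWindowRigidityAncient
open Summit.NavierStokesRegularity.NavierStokesRegularity.Theorems.PoloidalWindowDoorPoloidalWindowRigidityLeafUniformPins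

/-! ## A negative-semidefinite symmetric form with a vanishing diagonal entry has a vanishing row -/

/-- For a bilinear expression `G` (here: `a b ↦ N·D²w(y)(a)(b)`, linear in each slot, symmetric) with `G a a ≤ 0` for all `a`:
`G a a = 0 ⇒ G a b = 0`. Stated for a continuous bilinear map `E3 →L E3 →L ℝ` scaled by `N`. -/
theorem row_eq_zero_of_nonpos_of_diag_eq_zero (L : EuclideanSpace ℝ (Fin 3) →L[ℝ] EuclideanSpace ℝ (Fin 3) →L[ℝ] ℝ) (N : ℝ)
    (hsymm : ∀ a b, L a b = L b a) (hnonpos : ∀ a, N * L a a ≤ 0) {a : EuclideanSpace ℝ (Fin 3)} (ha : N * L a a = 0)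
    (b : EuclideanSpace ℝ (Fin 3)) : N * L a b = 0 := by
  set g : ℝ := N * L a b with hg
  set h : ℝ := N * L b b with hh
  have hh0 : h ≤ 0 := hnonpos b
  -- the quadratic `t ↦ N·L(a+tb)(a+tb) = 2 t g + t² h ≤ 0`
  have hquad : ∀ t : ℝ, 2 * t * g + t ^ 2 * h ≤ 0 := by
    intro t
    have h1 := hnonpos (a + t • b)
    have e1 : L (a + t • b) (a + t • b) = L a a + t * L a b + t * L b a + t ^ 2 * L b b := by
      simp only [map_add, map_smul, FunLike.coe_add, FunLike.coe_smul, Pi.add_apply, Pi.smul_apply, smul_eq_mul]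
      ring
    rw [e1, hsymm b a] at h1
    have : N * (L a a + t * L a b + t * L a b + t ^ 2 * L b b) = N * L a a + 2 * t * (N * L a b) + t ^ 2 * (N * L b b) := by ring
    rw [this, ha] at h1
    linarith
  -- choose `t = s g` with `s = 1/(1 + |h|)`
  set s : ℝ := 1 / (1 + |h|) with hs
  have hs0 : 0 < s := by rw [hs]; positivity
  have hs1 : s * |h| ≤ 1 := by
    rw [hs, div_mul_eq_mul_div, one_mul, div_le_one (by positivity)]
    linarith [abs_nonneg h]
  have h2 := hquad (s * g)
  -- `g² · s · (2 − s|h|) ≤ 0` with `s(2 − s|h|) > 0`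
  have h3 : g ^ 2 * (s * (2 + s * h)) ≤ 0 := by nlinarith [h2]
  have h4 : 0 < s * (2 + s * h) := by
    have : -|h| ≤ h := neg_abs_le h
    have : 1 ≤ 2 + s * h := by nlinarith [hs1, this, hs0.le]
    positivity
  have h5 : g ^ 2 ≤ 0 := by
    by_contra hcon
    push Not at hcon
    have := mul_pos hcon h4
    linarith
  exact pow_eq_zero_iff (n := 2) (by norm_num) |>.1 (le_antisymm h5 (sq_nonneg g))

/-- A horizontal vector is the combination of the two horizontal coordinate vectors. -/
theorem horizontal_decomp' {e : EuclideanSpace ℝ (Fin 3)} (he : e 2 = 0) :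
    e = e 0 • EuclideanSpace.single 0 (1 : ℝ) + e 1 • EuclideanSpace.single 1 (1 : ℝ) := by
  ext i
  fin_cases i <;> simp [he]

/-! ## R20 -/

/-- **R20 `HotFlatPointHFlat` (VERBATIM, `Pinned`/`hotSet`/`lapH`/`hess`/`HFlat` unfolded)**: a hot point with `Δₕv₂(−1,·) = 0` is horizontally flat. -/
theorem hotFlatPointHFlat :
    ∀ (C : ℝ) (v : ℝ → EuclideanSpace ℝ (Fin 3) → EuclideanSpace ℝ (Fin 3)),
      (Literature.Analysis.FluidPDE.HasTypeITimeDecay C v ∧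
        ContinuousOn (Function.uncurry v) (Set.Iio (0 : ℝ) ×ˢ Set.univ) ∧
        (∀ s t : ℝ, s < t → t < 0 → ∀ x, v t x =
          Literature.Analysis.UnboundedOperators.heatExtension (v s) (t - s) x -
            Literature.Analysis.FluidPDE.oseenDuhamel 1 s v v t x) ∧
        (∀ t < 0, Literature.Analysis.FluidPDE.VectorCalculus.IsDivFree (v t)) ∧
        (∀ s < 0, ∀ y, ⟪Literature.Analysis.FluidPDE.curl (v s) y, EuclideanSpace.single 2 1⟫_ℝ = 0) ∧
        v (-1) 0 2 ≠ 0 ∧ (∀ t < 0, ∀ x, Real.sqrt (-t) * |v t x 2| ≤ |v (-1) 0 2|) ∧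
        (∀ h : EuclideanSpace ℝ (Fin 3), fderiv ℝ (v (-1)) 0 h 2 = 0) ∧
        (deriv (fun s => v s 0 2) (-1) = v (-1) 0 2 / 2 ∧ v (-1) 0 2 * (Δ (fun y => v (-1) y 2)) 0 ≤ 0)) →
      ∀ y ∈ {y : EuclideanSpace ℝ (Fin 3) | y 2 = 0 ∧ v (-1) y 2 = v (-1) 0 2},
        fderiv ℝ (fun x => fderiv ℝ (fun x' => v (-1) x' 2) x (EuclideanSpace.single 0 1)) y (EuclideanSpace.single 0 1) +
            fderiv ℝ (fun x => fderiv ℝ (fun x' => v (-1) x' 2) x (EuclideanSpace.single 1 1)) y (EuclideanSpace.single 1 1) = 0 →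
        ∀ a b : EuclideanSpace ℝ (Fin 3), a 2 = 0 →
          fderiv ℝ (fun x => fderiv ℝ (fun x' => v (-1) x' 2) x a) y b = 0 ∧
            fderiv ℝ (fun x => fderiv ℝ (fun x' => v (-1) x' 2) x b) y a = 0 := by
  intro C v hP y hy hlap a b ha
  obtain ⟨hrate, hcont, hmild, -, -, hN, hsup, -, -⟩ := hP
  obtain ⟨-, hyN⟩ := hy
  set f : EuclideanSpace ℝ (Fin 3) → ℝ := fun x => v (-1) x 2 with hf
  have hfa : ContDiff ℝ 2 f := by
    have hsl := analyticOnNhd_slice hcont (bdd_of_hasTypeITimeDecay hrate) hmild (by norm_num : (-1 : ℝ) < 0)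
    have han : AnalyticOnNhd ℝ f univ := fun x _ =>
      ((EuclideanSpace.proj (𝕜 := ℝ) (2 : Fin 3)).analyticAt _).comp (hsl x (mem_univ _))
    exact han.contDiff
  have hmax : ∀ x, |f x| ≤ |f y| := fun x => by
    have h := hsup (-1) (by norm_num) x
    have hR : Real.sqrt (-(-1 : ℝ)) = 1 := by norm_num
    rw [hR, one_mul] at h
    show |v (-1) x 2| ≤ |v (-1) y 2|
    rw [hyN]; exact h
  have hfy : f y = v (-1) 0 2 := hyN
  -- the symmetric second derivative as a bilinear map
  set L : EuclideanSpace ℝ (Fin 3) →L[ℝ] EuclideanSpace ℝ (Fin 3) →L[ℝ] ℝ := fderiv ℝ (fderiv ℝ f) y with hL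
  have hsymm : ∀ p q, L p q = L q p := fun p q =>
    (hfa.contDiffAt.isSymmSndFDerivAt (by simp)).eq p q
  -- dictionary: nested spelling = `L b a`
  have hdict : ∀ p q : EuclideanSpace ℝ (Fin 3), fderiv ℝ (fun x => fderiv ℝ f x p) y q = L q p := by
    intro p q
    rw [Literature.Analysis.FluidPDE.fderiv_fderiv_apply_eq_iteratedFDeriv hfa y p q, iteratedFDeriv_two_apply]
    simp [hL]
  -- negative semidefiniteness of `N·L`
  have hnonpos : ∀ p, f y * L p p ≤ 0 := by
    intro p
    have h1 := mul_iteratedFDeriv_two_nonpos hfa hmax p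
    rw [iteratedFDeriv_two_apply] at h1
    simpa [hL] using h1
  -- the two diagonal entries vanish
  have hlap' : f y * L (EuclideanSpace.single 0 1) (EuclideanSpace.single 0 1) + f y * L (EuclideanSpace.single 1 1) (EuclideanSpace.single 1 1) = 0 := by
    have h1 : fderiv ℝ (fun x => fderiv ℝ f x (EuclideanSpace.single 0 1)) y (EuclideanSpace.single 0 1) +
        fderiv ℝ (fun x => fderiv ℝ f x (EuclideanSpace.single 1 1)) y (EuclideanSpace.single 1 1) = 0 := hlap
    rw [hdict, hdict] at h1
    rw [← mul_add, h1, mul_zero]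
  have h00 : f y * L (EuclideanSpace.single 0 1) (EuclideanSpace.single 0 1) = 0 :=
    le_antisymm (hnonpos _) (by linarith [hnonpos (EuclideanSpace.single 1 (1 : ℝ))])
  have h11 : f y * L (EuclideanSpace.single 1 1) (EuclideanSpace.single 1 1) = 0 := by linarith
  -- rows of `e₀`, `e₁` vanish
  have hrow0 : ∀ q, f y * L (EuclideanSpace.single 0 1) q = 0 :=
    row_eq_zero_of_nonpos_of_diag_eq_zero L (f y) hsymm hnonpos h00
  have hrow1 : ∀ q, f y * L (EuclideanSpace.single 1 1) q = 0 :=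
    row_eq_zero_of_nonpos_of_diag_eq_zero L (f y) hsymm hnonpos h11
  have hNne : f y ≠ 0 := by rw [hfy]; exact hN
  have hrowa : ∀ q, L a q = 0 := by
    intro q
    have e1 : L a q = a 0 * L (EuclideanSpace.single 0 1) q + a 1 * L (EuclideanSpace.single 1 1) q := by
      conv_lhs => rw [horizontal_decomp' ha]
      simp only [map_add, map_smul, FunLike.coe_add, FunLike.coe_smul, Pi.add_apply, Pi.smul_apply, smul_eq_mul]
    have h0 : L (EuclideanSpace.single 0 1) q = 0 := (mul_eq_zero.1 (hrow0 q)).resolve_left hNne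
    have h1 : L (EuclideanSpace.single 1 1) q = 0 := (mul_eq_zero.1 (hrow1 q)).resolve_left hNne
    rw [e1, h0, h1, mul_zero, mul_zero, add_zero]
  refine ⟨?_, ?_⟩
  · show fderiv ℝ (fun x => fderiv ℝ f x a) y b = 0
    rw [hdict, hsymm, hrowa]
  · show fderiv ℝ (fun x => fderiv ℝ f x b) y a = 0
    rw [hdict, hrowa]

end Summit.NavierStokesRegularity.NavierStokesRegularity.Theorems.PoloidalWindowDoorPoloidalWindowRigidityLeafUniformHFlat

end
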